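import Summits.QuantumFields.YangMills.Theorems.BalabanUVNodesK1R9BodyAtRevisedRecordWorldOfNodesRunLetters

/-!
# BalabanUVNodes ∕ K1⁹ LINE 2 — RUNG 1ⱽ (`NodesAtSomeRecord13PWSⱽ`) ASSEMBLED FROM LINE 1's RUNG-1 DATA MINUS N13 PLUS THE SLOT's COR-3 CONJUNCT: an S-bound `RecordS` world of `(θ, h)` with the
# ELEVEN nodes `B4_main … B14_main`, `B15_main`, the 𝐑-leaf, N08's `PrintedUV3V`, the N12 `lam`-clause — and a slot `v` with `B16.Cor3With (datumOfRecord₁₃SepCoPHV θ h v).C γ₁ w.em w.ep` — give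
# the rung-1ⱽ TEXT of plan g86's registered K1 «v9» skeleton at the witness world `{w with C := (datumⱽ v).C}` (Track A; cluster K1 — K1⁹ `StabilityBRunRowsAtRecordR13SepCoPHV` =
# stmt-QuantumFields-27364, helper for the registered stub `stub_nodes13PWSV`; seat `pub-ymgap-dag-n13-w3` g4 (N13 [B16]); sequel of p624688 ∕ p627483; 2026-08-28; count-neutral)

HONEST FRAMING.  Count-neutral GLUE by name; nothing of Bałaban's is asserted or refuted; NO stub closed (a rung text from displayed families is not a stub proof).  Plan g86's K1 «v9»
(e3ea62ca8052a293) = LINE 1 (v8's three stubs) ∪ LINE 2 (`stub_nodes13PWSV` ∕ `stub_runRows13PWSV` ∕ `stub_cont13V` over the slot class `RecordSV`); dag-n24-c's engines produce, at an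
S-bound world `w` of the UNREVISED datum, the eleven nodes `B4_main … B14_main` + the 𝐑-leaf (Part 36, N13-free) — N13's pointwise pin there is what director-ym №210 located as
version-decided.  THIS FILE shows what LINE 2's rung 1ⱽ then costs at N13: EXACTLY a slot `v` with [III] Cor. 3 «with e±» AT THE REVISED DATUM in the world's letters — the slot chain's
output from Theorem 1 + the version-free rows (dag-n13-w1 p620313 ∕ p622796, dag-n13-w2 p619268 ∕ p621421 ∕ p623210, this seat p621736 ∕ p622818) — every other rung-1 conjunct transfers
VERBATIM from the unrevised world (p624688: only `B16_main` reads `uvBounds`).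
* §1 `leavesP_congr_C` (`w.C = X → leavesP w P = leavesP {w with C := X} P`) · `nodes_of_nodes11_b15_b16` (generic `Dag.Leaves`) · ★★ `nodes_at_recordV₁₃_of_nodes11_b15_of_rOperation_of_cor3With`
  (eleven + `B15_main` at ANY world `w₀` with `w₀.C = (datumOfRecord₁₃SepCoPH θ h).C` and the SAME other letters, the 𝐑-leaf, `w.γ ≤ γ₁`, `Cor3With (datumⱽ v).C γ₁ w.em w.ep`, `w.C = (datumⱽ v).C`
  ⟹ `Nodes (leavesP w P)`; N13 by p627483's binding-agnostic `b16_main_at_recordV₁₃_of_rOperation_of_cor3With`).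
* §2 ★★★ `rung1V_text_of_rung1Data_of_cor3With` (`N = 2`): the v9 rung-1ⱽ TEXT «`∃ θ h v w`, unity ∧ adm ∧ `RecordSV` ∧ `∀ P, Nodes (leavesP w P)` ∧ `PrintedUV3V 2 θ.L` ∧ `∃ lam, …`» from LINE 1's
  rung-1 data minus N13 at `w₀` plus the slot's Cor-3 conjunct in `w₀`'s letters; witness world `{w₀ with C := (datumⱽ v).C}`.
* §3 ★★ `rung1V_text_of_rung1Data_of_endStatementBPrinted` — the same from the slot LETTER's body `B16.EndStatementBPrinted (datumⱽ v).C` when the world's letters ARE the body's `γ₁ em ep`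
  (`w₀.γ ≤ γ₁`, `w₀.em = em`, `w₀.ep = ep`: the engine builds `w₀` after the slot witness, as p624688 §3 reads it).
DISPLAYED (LOCATED): the eleven nodes, `B15_main`, the 𝐑-leaf, `PrintedUV3V`, the `lam`-clause (LINE 1's families, other lanes), and the slot's `Cor3With` (= (2.50) a.e. ∕ in measure at levels ≥ 1
+ level 0 pointwise, via the slot chain — Bałaban's theorem proper at the tree's selector laws).  `stub_nodes13PWSV` NOT closed; K1⁹ ∕ K3⁸ ∕ K0⁷ OPEN; N13 NOT discharged; counts unmoved (typed
28∕28 · discharged 5∕27 · Track A 5∕28).  ONE finite four-torus programme at fixed `ε = L^{−K}`, Bałaban AS PRINTED; R4 closes the conditional finite-𝕋⁴ rung `BalabanLadder.UV` only — the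
Yang–Mills mass gap (Clay) is NOT proved by any of this; nothing continuum ∕ ℝ⁴ ∕ OS.  No `sorry`, `def`, `instance`, `notation`.

Sources: [Balaban1989LargeFieldII] Thm 1 + (0.1) pp.355–356, p.387, p.391; [Balaban1988Convergent] (0.2) p.244, Cor. 3 (2.50) p.264; [Balaban1985UV3] Thm 1 p.257, Thm 2 p.272;
[Balaban1989LargeFieldI] (0.4)–(0.6) p.176 (statement shapes only).
-/

noncomputable section

open scoped Matrix.Norms.L2Operator

namespace Summit.QuantumFields.YangMills.BalabanUVNodes.K1R9Line2Rung1VOfElevenNodesB15AndSlot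

open Literature.MathematicalPhysics.QuantumFieldTheory.Balaban1983to89
open Literature.MathematicalPhysics.QuantumFieldTheory.Balaban1983to89.Node00
open DagBinding T4Continuum T4DatumAssembly
open Summit.QuantumFields.YangMills.BalabanUVNodes.N13NodeAtRevisedRecordWorldAtRecord13SepCoPHV (leavesP_revision₁₃_eq_update)
open Summit.QuantumFields.YangMills.BalabanUVNodes.K1R9BodyAtRevisedRecordWorldOfNodesRunLetters (b16_main_at_recordV₁₃_of_rOperation_of_cor3With)

variable {F : T4Family} {N : ℕ} [NeZero N]

/-! ## §1. Leaf-tuple glue: re-binding the construction; eleven + one + one = thirteen; N13 at the revised world by the slot -/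

section Glue

/-- Re-binding a world's construction to ITSELF (propositionally) does not change the run's leaf tuple (`cases w; subst; rfl`). [cite: Balaban1989LargeFieldII, Thm 1 p.355 (bookkeeping)] -/
theorem leavesP_congr_C (w : WorldP) {X : B16.Construction} (hC : w.C = X) (P : B12.RunParams) : leavesP w P = leavesP { w with C := X } P := by
  obtain ⟨C, γ, em, ep, βup, β₀, β₀_pos, b, b_pos, L, one_lt_L, gR, up⟩ := w
  cases hC
  rfl

/-- Thirteen = eleven + `B15_main` + `B16_main` (the definition of `Nodes`, repackaged in dag-n24-c's Part 36 shape). [cite: Balaban1989LargeFieldII, Thm 1 p.355 (bookkeeping)] -/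
theorem nodes_of_nodes11_b15_b16 (ℓ : Dag.Leaves)
    (h11 : Dag.B4_main ℓ ∧ Dag.B5_main ℓ ∧ Dag.B6_main ℓ ∧ Dag.B7_main ℓ ∧ Dag.B8_main ℓ ∧ Dag.B9_main ℓ ∧ Dag.B10_main ℓ ∧ Dag.B11_main ℓ ∧
      Dag.B12_main ℓ ∧ Dag.B13_main ℓ ∧ Dag.B14_main ℓ)
    (h15 : Dag.B15_main ℓ) (h16 : Dag.B16_main ℓ) : Nodes ℓ := by
  obtain ⟨h4, h5, h6, h7, h8, h9, h10, h11', h12, h13, h14⟩ := h11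
  exact ⟨h4, h5, h6, h7, h8, h9, h10, h11', h12, h13, h14, h15, h16⟩

variable (θ : Stage13HParams F N) (h : θ.Provisos₁₃SepCoPH F N) (v : Revision₁₃ F N θ h)

/-- **★★ THE THIRTEEN NODES AT THE REVISED WORLD FROM ELEVEN + `B15_main` AT THE UNREVISED TWIN, THE 𝐑-LEAF, AND THE SLOT's COR-3 CONJUNCT.**  `w₀` any world bound to the record datum
(`w₀.C = (datumOfRecord₁₃SepCoPH θ h).C` — where the engines prove the eleven nodes and `B15_main`), `w := {w₀ with C := (datumOfRecord₁₃SepCoPHV θ h v).C}` its REVISED twin: the eleven and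
`B15_main` transfer (only `B16_main` reads `uvBounds`, p624688), and N13 at `w` is p627483's binding-agnostic `b16_main_at_recordV₁₃_of_rOperation_of_cor3With` from `(w₀.up P).rOperation`,
`w₀.γ ≤ γ₁`, `B16.Cor3With (datumⱽ v).C γ₁ w₀.em w₀.ep`.  HYPOTHESES displayed; no node discharged. [cite: Balaban1989LargeFieldII, Thm 1 p.355, (0.1) pp.355–356, p.387; Balaban1988Convergent, Cor. 3 (2.50) p.264 (bookkeeping)] -/
theorem nodes_at_recordV₁₃_of_nodes11_b15_of_rOperation_of_cor3With (w₀ : WorldP) (P : B12.RunParams) (hC₀ : w₀.C = (datumOfRecord₁₃SepCoPH F N θ h).C)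
    (h11 : Dag.B4_main (leavesP w₀ P) ∧ Dag.B5_main (leavesP w₀ P) ∧ Dag.B6_main (leavesP w₀ P) ∧ Dag.B7_main (leavesP w₀ P) ∧ Dag.B8_main (leavesP w₀ P) ∧
      Dag.B9_main (leavesP w₀ P) ∧ Dag.B10_main (leavesP w₀ P) ∧ Dag.B11_main (leavesP w₀ P) ∧ Dag.B12_main (leavesP w₀ P) ∧ Dag.B13_main (leavesP w₀ P) ∧ Dag.B14_main (leavesP w₀ P))
    (h15 : Dag.B15_main (leavesP w₀ P)) (hRop : (w₀.up P).rOperation) {γ₁ : ℝ} (hγ : w₀.γ ≤ γ₁)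
    (hcor : B16.Cor3With (datumOfRecord₁₃SepCoPHV F N θ h v).C γ₁ w₀.em w₀.ep) :
    Nodes (leavesP ({ w₀ with C := (datumOfRecord₁₃SepCoPHV F N θ h v).C } : WorldP) P) := by
  have h16 : Dag.B16_main (leavesP ({ w₀ with C := (datumOfRecord₁₃SepCoPHV F N θ h v).C } : WorldP) P) :=
    b16_main_at_recordV₁₃_of_rOperation_of_cor3With θ h v { w₀ with C := (datumOfRecord₁₃SepCoPHV F N θ h v).C } P rfl hRop hγ hcor
  rw [leavesP_revision₁₃_eq_update F N θ h v { w₀ with C := (datumOfRecord₁₃SepCoPHV F N θ h v).C } P rfl] at h16 ⊢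
  rw [leavesP_congr_C w₀ hC₀ P] at h11 h15
  obtain ⟨h4, h5, h6, h7, h8, h9, h10, h11', h12, h13, h14⟩ := h11
  exact ⟨h4, h5, h6, h7, h8, h9, h10, h11', h12, h13, h14, h15, h16⟩

end Glue

/-! ## §2. ★★★ The v9 rung-1ⱽ TEXT from LINE 1's rung-1 data minus N13 plus the slot's Cor-3 conjunct (`N = 2`) -/

section Rung

variable (θ : Stage13HParams F 2) (h : θ.Provisos₁₃SepCoPH F 2)

/-- **★★★ RUNG 1ⱽ OF K1 «v9» (`NodesAtSomeRecord13PWSV F`, TEXT verbatim) FROM LINE 1's RUNG-1 DATA MINUS N13 PLUS THE SLOT.**  Inputs, all displayed: unity ∧ slots, admissibility; an S-bound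
world `w₀` of `(θ, h)` (v8's `RecordS` text); at every run the ELEVEN nodes `B4_main … B14_main` (dag-n24-c's Part 36 shape), `B15_main` (N12), the 𝐑-leaf `(w₀.up P).rOperation`; N08's
`PrintedUV3V 2 θ.L`; the N12 `lam`-clause at `w₀`; a slot `v : Revision₁₃ F 2 θ h` with `B16.Cor3With (datumOfRecord₁₃SepCoPHV F 2 θ h v).C γ₁ w₀.em w₀.ep` and `w₀.γ ≤ γ₁`.  Output: the
rung-1ⱽ text with witness `(θ, h, v, {w₀ with C := (datumⱽ v).C})` — `RecordSV` is `RecordS` with its `w.C` clause replaced by `rfl`, the nodes by §1, the `lam`-clause reads `w.up` only.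
So on LINE 2 the N13 family an engine displays is «∃ v γ₁, Cor3With (datumⱽ v).C γ₁ em ep» — never the unrevised pointwise pin.  CONDITIONAL; `stub_nodes13PWSV` NOT closed.
[cite: Balaban1989LargeFieldII, Thm 1 p.355, (0.1) pp.355–356, p.387, p.391; Balaban1988Convergent, (0.2) p.244, Cor. 3 (2.50) p.264; Balaban1985UV3, Thm 1 p.257, Thm 2 p.272; Balaban1989LargeFieldI, (0.4)–(0.6) p.176 (statement shapes)] -/
theorem rung1V_text_of_rung1Data_of_cor3With (hU : θ.ZhUnity F 2 ∧ θ.SlotsNondegenerate₁₃ F 2) (hθ : θ.Admissible F 2) (w₀ : WorldP)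
    (hR : ∃ (θ' : Stage13HParams F 2) (h' : θ'.Provisos₁₃SepCoPH F 2), θ'.Admissible F 2 ∧
      datumOfRecord₁₃SepCoPH F 2 θ h = datumOfRecord₁₃SepCoPH F 2 θ' h' ∧ w₀.C = (datumOfRecord₁₃SepCoPH F 2 θ h).C ∧ (0 < w₀.γ ∧ w₀.γ ≤ θ'.γ) ∧
      w₀.L = (θ'.L : ℝ) ∧ ∀ P : B12.RunParams, w₀.up P = upOfRecord₅CS F 2 (θ'.toStage5₁₃CoPH F 2) P)
    (h11 : ∀ P : B12.RunParams, Dag.B4_main (leavesP w₀ P) ∧ Dag.B5_main (leavesP w₀ P) ∧ Dag.B6_main (leavesP w₀ P) ∧ Dag.B7_main (leavesP w₀ P) ∧ Dag.B8_main (leavesP w₀ P) ∧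
      Dag.B9_main (leavesP w₀ P) ∧ Dag.B10_main (leavesP w₀ P) ∧ Dag.B11_main (leavesP w₀ P) ∧ Dag.B12_main (leavesP w₀ P) ∧ Dag.B13_main (leavesP w₀ P) ∧ Dag.B14_main (leavesP w₀ P))
    (h15 : ∀ P : B12.RunParams, Dag.B15_main (leavesP w₀ P)) (hRop : ∀ P : B12.RunParams, (w₀.up P).rOperation) (h08 : PrintedUV3V 2 θ.L)
    (hlam : ∃ lam : ResidW F 2, (∀ P : B12.RunParams, 1 ≤ P.K → lam.kSel P < P.K) ∧
      ∀ P : B12.RunParams, lam.kSel P < P.K → ((leavesP w₀ P).rBasicStep ↔ B15Leaf (WOfRecord₁₃ F 2 θ.toStage13Params lam P)))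
    (v : Revision₁₃ F 2 θ h) {γ₁ : ℝ} (hγ : w₀.γ ≤ γ₁) (hcor : B16.Cor3With (datumOfRecord₁₃SepCoPHV F 2 θ h v).C γ₁ w₀.em w₀.ep) :
    ∃ (θ : Stage13HParams F 2) (h : θ.Provisos₁₃SepCoPH F 2) (v : Revision₁₃ F 2 θ h) (w : WorldP), (θ.ZhUnity F 2 ∧ θ.SlotsNondegenerate₁₃ F 2) ∧ θ.Admissible F 2 ∧
      (∃ (θ' : Stage13HParams F 2) (h' : θ'.Provisos₁₃SepCoPH F 2), θ'.Admissible F 2 ∧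
        datumOfRecord₁₃SepCoPH F 2 θ h = datumOfRecord₁₃SepCoPH F 2 θ' h' ∧ w.C = (datumOfRecord₁₃SepCoPHV F 2 θ h v).C ∧ (0 < w.γ ∧ w.γ ≤ θ'.γ) ∧
        w.L = (θ'.L : ℝ) ∧ ∀ P : B12.RunParams, w.up P = upOfRecord₅CS F 2 (θ'.toStage5₁₃CoPH F 2) P) ∧
      (∀ P : B12.RunParams, Nodes (leavesP w P)) ∧ PrintedUV3V 2 θ.L ∧
      ∃ lam : ResidW F 2, (∀ P : B12.RunParams, 1 ≤ P.K → lam.kSel P < P.K) ∧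
        ∀ P : B12.RunParams, lam.kSel P < P.K → ((leavesP w P).rBasicStep ↔ B15Leaf (WOfRecord₁₃ F 2 θ.toStage13Params lam P)) := by
  obtain ⟨θ', h', hθ', hD, hC₀, hγw, hL, hup⟩ := hR
  obtain ⟨lam, hsel, hleaf⟩ := hlam
  refine ⟨θ, h, v, { w₀ with C := (datumOfRecord₁₃SepCoPHV F 2 θ h v).C }, hU, hθ, ⟨θ', h', hθ', hD, rfl, hγw, hL, hup⟩, fun P => ?_, h08, lam, hsel, fun P hk => ?_⟩
  · exact nodes_at_recordV₁₃_of_nodes11_b15_of_rOperation_of_cor3With θ h v w₀ P hC₀ (h11 P) (h15 P) (hRop P) hγ hcor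
  · exact hleaf P hk

/-- **★★ THE SAME FROM THE SLOT LETTER's BODY** `B16.EndStatementBPrinted (datumOfRecord₁₃SepCoPHV F 2 θ h v).C` (Theorem 1 ∧ `Cor3_250` there) when the engine has built its world with the
body's letters — stated as: for the body's `γ₁ em ep` (obtained first), ANY S-bound world `w₀` with `w₀.γ ≤ γ₁`, `w₀.em = em`, `w₀.ep = ep` and the LINE-1-minus-N13 data yields rung 1ⱽ.
[cite: Balaban1989LargeFieldII, Thm 1 p.355, (0.1) pp.355–356 (bookkeeping)] -/
theorem rung1V_text_of_rung1Data_of_endStatementBPrinted (hU : θ.ZhUnity F 2 ∧ θ.SlotsNondegenerate₁₃ F 2) (hθ : θ.Admissible F 2) (v : Revision₁₃ F 2 θ h)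
    (hB : B16.EndStatementBPrinted (datumOfRecord₁₃SepCoPHV F 2 θ h v).C) (h08 : PrintedUV3V 2 θ.L) :
    ∃ γ₁ : ℝ, 0 < γ₁ ∧ ∃ em ep : ℝ → ℝ, ∀ w₀ : WorldP,
      (∃ (θ' : Stage13HParams F 2) (h' : θ'.Provisos₁₃SepCoPH F 2), θ'.Admissible F 2 ∧
        datumOfRecord₁₃SepCoPH F 2 θ h = datumOfRecord₁₃SepCoPH F 2 θ' h' ∧ w₀.C = (datumOfRecord₁₃SepCoPH F 2 θ h).C ∧ (0 < w₀.γ ∧ w₀.γ ≤ θ'.γ) ∧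
        w₀.L = (θ'.L : ℝ) ∧ ∀ P : B12.RunParams, w₀.up P = upOfRecord₅CS F 2 (θ'.toStage5₁₃CoPH F 2) P) →
      (∀ P : B12.RunParams, Dag.B4_main (leavesP w₀ P) ∧ Dag.B5_main (leavesP w₀ P) ∧ Dag.B6_main (leavesP w₀ P) ∧ Dag.B7_main (leavesP w₀ P) ∧ Dag.B8_main (leavesP w₀ P) ∧
        Dag.B9_main (leavesP w₀ P) ∧ Dag.B10_main (leavesP w₀ P) ∧ Dag.B11_main (leavesP w₀ P) ∧ Dag.B12_main (leavesP w₀ P) ∧ Dag.B13_main (leavesP w₀ P) ∧ Dag.B14_main (leavesP w₀ P)) →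
      (∀ P : B12.RunParams, Dag.B15_main (leavesP w₀ P)) → (∀ P : B12.RunParams, (w₀.up P).rOperation) →
      (∃ lam : ResidW F 2, (∀ P : B12.RunParams, 1 ≤ P.K → lam.kSel P < P.K) ∧
        ∀ P : B12.RunParams, lam.kSel P < P.K → ((leavesP w₀ P).rBasicStep ↔ B15Leaf (WOfRecord₁₃ F 2 θ.toStage13Params lam P))) →
      w₀.γ ≤ γ₁ → w₀.em = em → w₀.ep = ep →
      ∃ (θ : Stage13HParams F 2) (h : θ.Provisos₁₃SepCoPH F 2) (v : Revision₁₃ F 2 θ h) (w : WorldP), (θ.ZhUnity F 2 ∧ θ.SlotsNondegenerate₁₃ F 2) ∧ θ.Admissible F 2 ∧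
        (∃ (θ' : Stage13HParams F 2) (h' : θ'.Provisos₁₃SepCoPH F 2), θ'.Admissible F 2 ∧
          datumOfRecord₁₃SepCoPH F 2 θ h = datumOfRecord₁₃SepCoPH F 2 θ' h' ∧ w.C = (datumOfRecord₁₃SepCoPHV F 2 θ h v).C ∧ (0 < w.γ ∧ w.γ ≤ θ'.γ) ∧
          w.L = (θ'.L : ℝ) ∧ ∀ P : B12.RunParams, w.up P = upOfRecord₅CS F 2 (θ'.toStage5₁₃CoPH F 2) P) ∧
        (∀ P : B12.RunParams, Nodes (leavesP w P)) ∧ PrintedUV3V 2 θ.L ∧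
        ∃ lam : ResidW F 2, (∀ P : B12.RunParams, 1 ≤ P.K → lam.kSel P < P.K) ∧
          ∀ P : B12.RunParams, lam.kSel P < P.K → ((leavesP w P).rBasicStep ↔ B15Leaf (WOfRecord₁₃ F 2 θ.toStage13Params lam P)) := by
  obtain ⟨-, γ₁, hγ₁, em, ep, hcor⟩ := hB
  refine ⟨γ₁, hγ₁, em, ep, fun w₀ hR h11 h15 hRop hlam hγ hem hep => ?_⟩
  refine rung1V_text_of_rung1Data_of_cor3With θ h hU hθ w₀ hR h11 h15 hRop h08 hlam v hγ ?_
  rw [hem, hep]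
  exact hcor

end Rung

end Summit.QuantumFields.YangMills.BalabanUVNodes.K1R9Line2Rung1VOfElevenNodesB15AndSlot

end
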